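import Summits.BirchSwinnertonDyer.BirchSwinnertonDyer.Theorems.CMKolyvaginAtInertTwoExactSumDefectLeOneAtTwo
import Summits.BirchSwinnertonDyer.BirchSwinnertonDyer.Theorems.CMKolyvaginAtInertTwoShaCountCompositeTwistAtTwo
import HarnessLib

/-!
# Route `CMKolyvaginAtInertTwo`, crux `CMKolyvaginExactAtInertTwo` (stmt-BirchSwinnertonDyer-24277):
# THE ONE-BIT CONDITION IN TAMAGAWA CURRENCY — `4 ∤ ∏_ℓ c_ℓ(E^{(d_K)})` — and the crux VERBATIM with it, modulo the five prints

Seat `bsd-line-cmk2-p1` g21 (cell `bsd-print-cf2`), `--supports stmt-BirchSwinnertonDyer-24277` (helper; closes nothing by name).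
THEOREMS ONLY (no definition, no named fact, no `sorry`).  BSD is NOT proved by any of this.

The capstone `cmKolyvaginExactAtInertTwo_of_sum_defect_le_one_of_printedInputs` (file `…ExactSumDefectLeOneAtTwo`) carries the genus defect as
g15's Jacobi–Frobenius sum `Σ = Σ_{q ∣ d_K} ([(Δ/q) = −1] + 2·[(Δ/q) = 1 ∧ a_q even])`.  By g15's composite Tamagawa bookkeeping
(`ShaCountTwo.padicValNat_two_tamagawaProduct_twist_of_heegner`: `ord₂ ∏ c(E^{(d_K)}) = ord₂ ∏ c(E) + Σ`, any equation of the twist) and the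
habitat's odd `∏ c(E)`, `Σ = ord₂ ∏_ℓ c_ℓ(E^{(d_K)})`; so `Σ ≤ 1` is the READABLE condition **«the Tamagawa product of the twin `E^{(d_K)}` is not
divisible by `4`»** (it is then exactly `2 ×` odd: the one transposition prime of `d_K`).  This is the form a route statement can carry without
the Jacobi sum — the twin `Wd` is already a binder of the supply crux 24276 and of the descent 22837.
* `sum_defect_le_one_of_not_four_dvd_tamagawaProduct_twin` — the dictionary;
* `card_primaryComponent_sha_two_baseChange_eq_pow_of_certificate_of_twin_tamagawa_of_printedInputs` — frame level;
* **`cmKolyvaginExactAtInertTwo_of_twin_tamagawa_of_printedInputs`** — crux 24277's signature VERBATIM followed by a twin equation `Wd` with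
  `¬ 4 ∣ Wd.tamagawaProduct`, Gross 3.7 (2) by name and the four prints (RESTATE option R1″ for the pen, equivalent to R1′ on the habitat).

References: [Kramer1981] Prop. 3; [JetchevSkinnerWan2017] §7.4.1; [McCallumLMS1991] §5 Thm. 5.4; [GrossLMS1991] Prop. 3.7 (2).
-/

set_option autoImplicit false
-- the Theorems namespace of this sub repeats the summit name by design (D-0017 nested layout)
set_option linter.dupNamespace false

noncomputable section

open scoped Classical

open WeierstrassCurve NumberField IsDedekindDomain Field Literature.NumberTheory.EllipticCurves
open Literature.NumberTheory.EllipticCurves.ModularForms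
open Literature.NumberTheory.EllipticCurves.GrossLMS1991 (prop37_2_reductionCongruence_inert)
open Summit.BirchSwinnertonDyer.BirchSwinnertonDyer.Theorems.GenusExact
open Summit.BirchSwinnertonDyer.Rank1Residual

namespace Summit.BirchSwinnertonDyer.BirchSwinnertonDyer.Theorems.KolyvaginLowerTwo

/-- **`4 ∤ ∏ c(E^{(d_K)}) ⟹ Σ ≤ 1`** for `W` globally minimal with odd Tamagawa product, `K` imaginary quadratic with odd `d_K`, Heegner, and ANY
equation `Wd = Cd • W^{(d_K)}` of the twist: `ord₂ ∏ c(Wd) = ord₂ ∏ c(W) + Σ = Σ` (g15). [cite: Kramer1981, Prop. 3]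
[cite: JetchevSkinnerWan2017, §7.4.1 (eq:tamK)] -/
theorem sum_defect_le_one_of_not_four_dvd_tamagawaProduct_twin (W : WeierstrassCurve ℚ) [W.IsElliptic] [W.IsGloballyMinimal]
    (hT : Odd W.tamagawaProduct) {K : Type} [Field K] [NumberField K] (hK : IsImaginaryQuadratic K) (hodd : Odd (NumberField.discr K))
    (hH : SatisfiesHeegnerHypothesis (W.conductorNorm ℤ) K) {Wd : WeierstrassCurve ℚ} [Wd.IsElliptic]
    (hWd : ∃ C : VariableChange ℚ, C • W.quadraticTwist (NumberField.discr K : ℚ) = Wd) (h4 : ¬ 4 ∣ Wd.tamagawaProduct) :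
    ∑ q ∈ (NumberField.discr K).natAbs.primeFactors,
        ((if jacobiSym W.Δ.num q = -1 then 1 else 0) +
          (if jacobiSym W.Δ.num q = 1 ∧ Even (W.frobeniusTrace q) then 2 else 0)) ≤ 1 := by
  haveI : Fact (Nat.Prime 2) := ⟨Nat.prime_two⟩
  obtain ⟨Cd, hCd⟩ := hWd
  have hv := ShaCountTwo.padicValNat_two_tamagawaProduct_twist_of_heegner W K hK hodd hH Cd hCd
  have hW0 : padicValNat 2 W.tamagawaProduct = 0 := padicValNat.eq_zero_of_not_dvd hT.not_two_dvd_nat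
  rw [hW0, zero_add] at hv
  rw [← hv]
  have hpos : Wd.tamagawaProduct ≠ 0 := Wd.tamagawaProduct_pos_holds.ne'
  by_contra hle
  apply h4
  have h2 : 2 ≤ padicValNat 2 Wd.tamagawaProduct := by omega
  have h := (padicValNat_dvd_iff_le hpos).mpr h2
  norm_num at h
  exact h

/-- **`#Ш(E_K)(2) = 2^{2M₀}` ON H₂ FROM THE CRUX'S CERTIFICATE WHEN THE TWIN'S TAMAGAWA PRODUCT IS NOT DIVISIBLE BY `4`**, modulo the four prints +
Gross 3.7 (2): the capstone `card_primaryComponent_sha_two_baseChange_eq_pow_of_certificate_of_sum_defect_le_one_of_printedInputs` through the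
dictionary above. [cite: McCallumLMS1991, §5 Thm. 5.4] [cite: Kramer1981, Prop. 3] [cite: GrossLMS1991, Prop. 3.7 (2)] -/
theorem card_primaryComponent_sha_two_baseChange_eq_pow_of_certificate_of_twin_tamagawa_of_printedInputs
    (hGZ : ∀ (N : ℕ) [NeZero N] (W : WeierstrassCurve ℚ) (K : Type) [Field K] [NumberField K], gross_zagier N W K)
    (hGZK : rank_eq_analyticRank_of_analyticRank_le_one) (hmod : hasEntireLFunction_rat)
    (hMilneC : Milne1972.bsdQuotient_baseChange_quadratic_anyModel)
    (W : WeierstrassCurve ℚ) [W.IsElliptic] [W.IsGloballyMinimal] [NeZero (W.conductorNorm ℤ)]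
    (hCM : W.HasCM) (hin : Rank1Residual.CMInert W 2) (hρ2 : W.HasSurjectiveModNGaloisRep 2)
    (hT : Odd W.tamagawaProduct) (K : Type) [Field K] [NumberField K] (hIQ : IsImaginaryQuadratic K)
    (hodd : Odd (NumberField.discr K)) (h3 : NumberField.discr K ≠ -3)
    (hHe : SatisfiesHeegnerHypothesis (W.conductorNorm ℤ) K)
    {Wd : WeierstrassCurve ℚ} [Wd.IsElliptic] (hWd : ∃ C : VariableChange ℚ, C • W.quadraticTwist (NumberField.discr K : ℚ) = Wd)
    (h4 : ¬ 4 ∣ Wd.tamagawaProduct)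
    (h37 : prop37_2_reductionCongruence_inert (W.conductorNorm ℤ) W K)
    (Dt : ModularParametrizationData W (W.conductorNorm ℤ)) (β : ℤ) (ι : K →+* ℂ) (d₁ : KolyvaginHeegnerData Dt β ι 1)
    (hy : ¬ IsOfFinAddOrder d₁.derivedPoint) (M₀ : ℕ)
    (hM₀ : ∃ Q : (W.baseChange (ringClassField K ι 1)).toAffine.Point, ((2 ^ M₀ : ℕ) : ℤ) • Q = d₁.derivedPoint)
    (hndiv : ¬ ∃ Q : (W.baseChange (ringClassField K ι 1)).toAffine.Point, ((2 ^ (M₀ + 1) : ℕ) : ℤ) • Q = d₁.derivedPoint)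
    {n : ℕ} (d : KolyvaginHeegnerData Dt β ι n) (hn : Squarefree n)
    (hKoly : ∀ ℓ ∈ n.primeFactors, Zhang2014.IsKolyvaginPrime (W.conductorNorm ℤ) W K 2 ℓ ∧ Rank1Residual.CMInert W ℓ)
    (hPn : ¬ ∃ Q : (W.baseChange (ringClassField K ι n)).toAffine.Point, (2 : ℤ) • Q = d.derivedPoint) :
    Nat.card (AddCommGroup.primaryComponent (W.baseChange K).sha 2) = 2 ^ (2 * M₀) :=
  card_primaryComponent_sha_two_baseChange_eq_pow_of_certificate_of_sum_defect_le_one_of_printedInputs hGZ hGZK hmod hMilneC W hCM hin hρ2 hT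
    K hIQ hodd h3 hHe (sum_defect_le_one_of_not_four_dvd_tamagawaProduct_twin W hT hIQ hodd hHe hWd h4) h37 Dt β ι d₁ hy M₀ hM₀ hndiv d hn
    hKoly hPn

/-- **Crux 24277's signature VERBATIM, followed by a twin equation `Wd` of `E^{(d_K)}` with `4 ∤ ∏ c(Wd)`, Gross 3.7 (2) by name and the four
prints** ⟹ the crux's conclusion (RESTATE option R1″: the one-bit condition in Tamagawa currency; on the habitat equivalent to `Σ ≤ 1` and to
«`d_K` has exactly one prime `q` with `E(ℚ_q)[2] ≠ 0`, and there `#E(ℚ_q)[2] = 2`»).  BSD is NOT proved by this; nothing is closed by name.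
[cite: McCallumLMS1991, §5 Thm. 5.4, Thm. 5.8] [cite: Kramer1981, Prop. 3] [cite: GrossLMS1991, Prop. 3.7 (2)] -/
theorem cmKolyvaginExactAtInertTwo_of_twin_tamagawa_of_printedInputs :
    ∀ (W : WeierstrassCurve ℚ) [W.IsElliptic] [W.IsGloballyMinimal] [NeZero (W.conductorNorm ℤ)], W.HasCM → Literature.NumberTheory.EllipticCurves.Rank1Residual.CMInert W 2 → W.HasSurjectiveModNGaloisRep (2 : ℤ) → Odd W.tamagawaProduct → ∀ (K : Type) [Field K] [NumberField K], Literature.NumberTheory.EllipticCurves.IsImaginaryQuadratic K → Odd (NumberField.discr K) → NumberField.discr K ≠ -3 → Literature.NumberTheory.EllipticCurves.SatisfiesHeegnerHypothesis (W.conductorNorm ℤ) K → ¬ IsSquare ((NumberField.discr K : ℚ) * -|W.Δ|) → ¬ IsSquare ((NumberField.discr K : ℚ) * (-(2 * |W.Δ|))) → ∀ (Dt : Literature.NumberTheory.EllipticCurves.ModularForms.ModularParametrizationData W (W.conductorNorm ℤ)) (β : ℤ) (ι : K →+* ℂ) (d₁ : Literature.NumberTheory.EllipticCurves.KolyvaginHeegnerData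 Dt β ι 1), ¬ IsOfFinAddOrder d₁.derivedPoint → ∀ (M₀ : ℕ), (∃ Q : (W.baseChange (Literature.NumberTheory.EllipticCurves.ringClassField K ι 1)).toAffine.Point, ((2 ^ M₀ : ℕ) : ℤ) • Q = d₁.derivedPoint) → (¬ ∃ Q : (W.baseChange (Literature.NumberTheory.EllipticCurves.ringClassField K ι 1)).toAffine.Point, ((2 ^ (M₀ + 1) : ℕ) : ℤ) • Q = d₁.derivedPoint) → ∀ (n : ℕ) (d : Literature.NumberTheory.EllipticCurves.KolyvaginHeegnerData Dt β ι n), Squarefree n → (∀ ℓ ∈ n.primeFactors, (Literature.NumberTheory.EllipticCurves.Zhang2014.IsKolyvaginPrime (W.conductorNorm ℤ) W K 2 ℓ ∧ Literature.NumberTheory.EllipticCurves.Rank1Residual.CMInert W ℓ)) → (¬ ∃ Q : (W.baseChange (Literature.NumberTheory.EllipticCurves.ringClassField K ι n)).toAffine.Point, (2 : ℤ) • Q = d.derivedPoint) →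
      -- the extra hypotheses
      ∀ (Wd : WeierstrassCurve ℚ) [Wd.IsElliptic], (∃ C : WeierstrassCurve.VariableChange ℚ, C • W.quadraticTwist (NumberField.discr K : ℚ) = Wd) →
      ¬ 4 ∣ Wd.tamagawaProduct →
      Literature.NumberTheory.EllipticCurves.GrossLMS1991.prop37_2_reductionCongruence_inert (W.conductorNorm ℤ) W K →
      (∀ (N : ℕ) [NeZero N] (W : WeierstrassCurve ℚ) (K : Type) [Field K] [NumberField K], gross_zagier N W K) →
      rank_eq_analyticRank_of_analyticRank_le_one → hasEntireLFunction_rat → Milne1972.bsdQuotient_baseChange_quadratic_anyModel →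
      Nat.card (AddCommGroup.primaryComponent (W.baseChange K).sha 2) = 2 ^ (2 * M₀) := by
  intro W _ _ _ hCM hin hρ hT K _ _ hK hodd h3 hH _ _ Dt β ι d₁ hy M₀ hdiv hndiv n d hn hKoly hPn Wd _ hWd h4 h37 hGZ hGZK hmod hMi
  exact card_primaryComponent_sha_two_baseChange_eq_pow_of_certificate_of_twin_tamagawa_of_printedInputs hGZ hGZK hmod hMi W hCM hin hρ hT K
    hK hodd h3 hH hWd h4 h37 Dt β ι d₁ hy M₀ hdiv hndiv d hn hKoly hPn

end Summit.BirchSwinnertonDyer.BirchSwinnertonDyer.Theorems.KolyvaginLowerTwo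

end
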